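import Summits.CriticalPhenomena.PercolationContinuityZ3.Theorems.PercNearOneGluingNoHeavyLowerTailFibreSwitchingEnvironment
import HarnessLib

/-!
# `NoHeavyLowerTail` (stmt-CriticalPhenomena-4575) — COORDINATE SPLITTING of three-copy fibres:
# `fibre (insert e D) k ≅ {R ⊆ Fin 3 : #R = k e} × fibre D (k with k e := 0)`

Support file (new-inequality factory seat `prim-ineq-gen-1`, gen 6; `--supports stmt-CriticalPhenomena-4575`).  No named facts,
no sorries.  Companion of `…FibreSwitchingEnvironment` (environment decomposition).

Every one-coordinate ("Bernstein", one-edge) argument about three-copy fibre sums — the terminal-operation closure of the factory's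
FINDING-12 §2, the Bernstein pieces of a cubic row along an edge (FINDING-12 §3, the `bern4` route), FINDING-9/10's section splits —
starts from the same bookkeeping: a triple of configurations inside `insert e D` with profile `k` is obtained in exactly one way from
a triple inside `D` with profile `k` off `e` (and `0` at `e`) by adding the coordinate `e` to a set `R` of exactly `k e` of the three
copies.  This file proves that bijection (`fibre_insert_eq`, `addTo_inj`) and the resulting re-summation formula
(`sum_fibre_insert`):  `Σ_{x ∈ fibre (insert e D) k} f x = Σ_{R ⊆ Fin 3, #R = k e} Σ_{y ∈ fibre D (update k e 0)} f (addTo e R y)`  for `e ∉ D`.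
-/

namespace Summit.CriticalPhenomena.PercolationContinuityZ3.Theorems

namespace FibreSplit

open Finset FibreSwitching FibreEnv
open Literature.Probability.Percolation.DecisionTree

noncomputable section

open Classical

variable {ι : Type*} [DecidableEq ι]

/-- Add the coordinate `e` to the copies with index in `R`. [this work] -/
def addTo (e : ι) (R : Finset (Fin 3)) (y : Fin 3 → Finset ι) : Fin 3 → Finset ι :=
  fun i => if i ∈ R then insert e (y i) else y i

/-- Remove the coordinate `e` from all three copies. [this work] -/
def strip (e : ι) (x : Fin 3 → Finset ι) : Fin 3 → Finset ι := fun i => (x i).erase e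

/-- The set of copies holding the coordinate `e`. [this work] -/
def holders (e : ι) (x : Fin 3 → Finset ι) : Finset (Fin 3) := univ.filter fun i => e ∈ x i

section Basic

variable (e : ι)

/-- Membership in a component of `addTo`. [this work] -/
theorem mem_addTo {R : Finset (Fin 3)} {y : Fin 3 → Finset ι} {i : Fin 3} {f : ι} :
    f ∈ addTo e R y i ↔ (f = e ∧ i ∈ R) ∨ f ∈ y i := by
  unfold addTo
  by_cases hi : i ∈ R
  · rw [if_pos hi, mem_insert]
    constructor
    · rintro (rfl | h)
      · exact Or.inl ⟨rfl, hi⟩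
      · exact Or.inr h
    · rintro (⟨rfl, -⟩ | h)
      · exact Or.inl rfl
      · exact Or.inr h
  · rw [if_neg hi]
    constructor
    · exact fun h => Or.inr h
    · rintro (⟨-, h⟩ | h)
      · exact absurd h hi
      · exact h

/-- Membership in `holders`. [this work] -/
theorem mem_holders {x : Fin 3 → Finset ι} {i : Fin 3} : i ∈ holders e x ↔ e ∈ x i := by
  unfold holders; simp

/-- The profile at `e` is the number of holders. [this work] -/
theorem profile_eq_card_holders (x : Fin 3 → Finset ι) : profile x e = (holders e x).card := by
  unfold profile holders
  rw [Finset.card_filter]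

/-- `strip` followed by `addTo` with the holders recovers the triple. [this work] -/
theorem addTo_holders_strip (x : Fin 3 → Finset ι) : addTo e (holders e x) (strip e x) = x := by
  funext i
  ext f
  rw [mem_addTo, mem_holders]
  unfold strip
  rw [mem_erase]
  constructor
  · rintro (⟨rfl, h⟩ | ⟨-, h⟩) <;> exact h
  · intro h
    by_cases hf : f = e
    · subst hf; exact Or.inl ⟨rfl, h⟩
    · exact Or.inr ⟨hf, h⟩

variable {e}

/-- If `e` is in no copy of `y`, the holders of `addTo e R y` are exactly `R`. [this work] -/
theorem holders_addTo {R : Finset (Fin 3)} {y : Fin 3 → Finset ι} (hy : ∀ i, e ∉ y i) :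
    holders e (addTo e R y) = R := by
  ext i
  rw [mem_holders, mem_addTo]
  constructor
  · rintro (⟨-, h⟩ | h)
    · exact h
    · exact absurd h (hy i)
  · exact fun h => Or.inl ⟨rfl, h⟩

/-- If `e` is in no copy of `y`, stripping `addTo e R y` recovers `y`. [this work] -/
theorem strip_addTo {R : Finset (Fin 3)} {y : Fin 3 → Finset ι} (hy : ∀ i, e ∉ y i) :
    strip e (addTo e R y) = y := by
  funext i
  ext f
  unfold strip
  rw [mem_erase, mem_addTo]
  constructor
  · rintro ⟨hf, ⟨hfe, -⟩ | h⟩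
    · exact absurd hfe hf
    · exact h
  · intro h
    exact ⟨fun hfe => hy i (hfe ▸ h), Or.inr h⟩

/-- The profile of `addTo e R y` at `e` is `#R` (when `e` is in no copy of `y`). [this work] -/
theorem profile_addTo_self {R : Finset (Fin 3)} {y : Fin 3 → Finset ι} (hy : ∀ i, e ∉ y i) :
    profile (addTo e R y) e = R.card := by
  rw [profile_eq_card_holders, holders_addTo hy]

/-- The profile of `addTo e R y` off `e` is that of `y`. [this work] -/
theorem profile_addTo_ne (R : Finset (Fin 3)) (y : Fin 3 → Finset ι) {f : ι} (hf : f ≠ e) :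
    profile (addTo e R y) f = profile y f := by
  unfold profile
  refine sum_congr rfl fun i _ => ?_
  have : f ∈ addTo e R y i ↔ f ∈ y i := by
    rw [mem_addTo]
    constructor
    · rintro (⟨h, -⟩ | h)
      · exact absurd h hf
      · exact h
    · exact fun h => Or.inr h
  simp only [this]

/-- The profile of `strip e x` off `e` is that of `x`. [this work] -/
theorem profile_strip_ne (x : Fin 3 → Finset ι) {f : ι} (hf : f ≠ e) : profile (strip e x) f = profile x f := by
  unfold profile strip
  refine sum_congr rfl fun i _ => ?_
  simp only [mem_erase, hf, ne_eq, not_false_eq_true, true_and]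

/-- The profile of `strip e x` at `e` is `0`. [this work] -/
theorem profile_strip_self (x : Fin 3 → Finset ι) : profile (strip e x) e = 0 := by
  unfold profile strip
  simp

end Basic

/-! ### The bijection -/

section Bij

variable {D : Finset ι} {e : ι} (he : e ∉ D) (k : ι → ℕ)
include he

/-- The index set of the splitting: subsets of the three copies of the right size. [this work] -/
def sizeSets (k : ι → ℕ) (e : ι) : Finset (Finset (Fin 3)) := univ.powerset.filter fun R => R.card = k e

omit [DecidableEq ι] he in
/-- Membership in `sizeSets`. [this work] -/
theorem mem_sizeSets {R : Finset (Fin 3)} : R ∈ sizeSets k e ↔ R.card = k e := by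
  unfold sizeSets; simp

/-- Forward direction: a fibre element of `insert e D` strips to a fibre element of `D` for the profile `update k e 0`,
and its holders have size `k e`. [this work] -/
theorem strip_mem_fibre {x : Fin 3 → Finset ι} (hx : x ∈ fibre (insert e D) k) :
    strip e x ∈ fibre D (Function.update k e 0) ∧ holders e x ∈ sizeSets k e := by
  obtain ⟨hxD, hprof⟩ := mem_fibre_iff.1 hx
  have hsub := mem_triples.1 hxD
  refine ⟨mem_fibre_iff.2 ⟨?_, ?_⟩, ?_⟩
  · rw [mem_triples]
    intro i f hf
    unfold strip at hf
    rw [mem_erase] at hf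
    rcases mem_insert.1 (hsub i hf.2) with h | h
    · exact absurd h hf.1
    · exact h
  · funext f
    by_cases hf : f = e
    · subst hf
      rw [profile_strip_self, Function.update_self]
    · rw [profile_strip_ne x hf, Function.update_of_ne hf]
      exact congrFun hprof f
  · rw [mem_sizeSets, ← profile_eq_card_holders]
    exact congrFun hprof e

/-- Backward direction: adding `e` to `#R = k e` copies of a fibre element of `D` (profile `update k e 0`) gives a fibre element of
`insert e D` with profile `k`. [this work] -/
theorem addTo_mem_fibre {R : Finset (Fin 3)} (hR : R ∈ sizeSets k e) {y : Fin 3 → Finset ι}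
    (hy : y ∈ fibre D (Function.update k e 0)) : addTo e R y ∈ fibre (insert e D) k := by
  obtain ⟨hyD, hprof⟩ := mem_fibre_iff.1 hy
  have hsub := mem_triples.1 hyD
  have hye : ∀ i, e ∉ y i := fun i h => he (hsub i h)
  refine mem_fibre_iff.2 ⟨?_, ?_⟩
  · rw [mem_triples]
    intro i f hf
    rcases (mem_addTo e).1 hf with ⟨rfl, -⟩ | h
    · exact mem_insert_self _ _
    · exact mem_insert_of_mem (hsub i h)
  · funext f
    by_cases hf : f = e
    · subst hf
      rw [profile_addTo_self hye]
      exact (mem_sizeSets k).1 hR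
    · rw [profile_addTo_ne R y hf]
      have := congrFun hprof f
      rw [Function.update_of_ne hf] at this
      exact this

/-- `addTo e` is injective on `sizeSets × fibre D (update k e 0)`. [this work] -/
theorem addTo_inj {R R' : Finset (Fin 3)} {y y' : Fin 3 → Finset ι} (hy : y ∈ fibre D (Function.update k e 0))
    (hy' : y' ∈ fibre D (Function.update k e 0)) (h : addTo e R y = addTo e R' y') : R = R' ∧ y = y' := by
  have hye : ∀ i, e ∉ y i := fun i hh => he (mem_triples.1 (mem_fibre_iff.1 hy).1 i hh)
  have hye' : ∀ i, e ∉ y' i := fun i hh => he (mem_triples.1 (mem_fibre_iff.1 hy').1 i hh)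
  constructor
  · rw [← holders_addTo (R := R) hye, ← holders_addTo (R := R') hye', h]
  · rw [← strip_addTo (R := R) hye, ← strip_addTo (R := R') hye', h]

/-- **Coordinate splitting.**  For `e ∉ D`, the fibre of `insert e D` at profile `k` is the image of
`sizeSets k e ×ˢ fibre D (update k e 0)` under `(R, y) ↦ addTo e R y`. [this work] -/
theorem fibre_insert_eq :
    fibre (insert e D) k = (sizeSets k e ×ˢ fibre D (Function.update k e 0)).image fun p => addTo e p.1 p.2 := by
  ext x
  rw [mem_image]
  constructor
  · intro hx
    obtain ⟨h1, h2⟩ := strip_mem_fibre he k hx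
    exact ⟨(holders e x, strip e x), mem_product.2 ⟨h2, h1⟩, addTo_holders_strip e x⟩
  · rintro ⟨⟨R, y⟩, hp, rfl⟩
    obtain ⟨hR, hy⟩ := mem_product.1 hp
    exact addTo_mem_fibre he k hR hy

/-- **Re-summation along one coordinate.**  For `e ∉ D` and every `f`,
`Σ_{x ∈ fibre (insert e D) k} f x = Σ_{R ⊆ Fin 3, #R = k e} Σ_{y ∈ fibre D (update k e 0)} f (addTo e R y)`. [this work] -/
theorem sum_fibre_insert {M : Type*} [AddCommMonoid M] (f : (Fin 3 → Finset ι) → M) :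
    ∑ x ∈ fibre (insert e D) k, f x =
      ∑ R ∈ sizeSets k e, ∑ y ∈ fibre D (Function.update k e 0), f (addTo e R y) := by
  rw [fibre_insert_eq he k, sum_image, sum_product]
  rintro ⟨R, y⟩ hp ⟨R', y'⟩ hp' h
  obtain ⟨-, hy⟩ := mem_product.1 hp
  obtain ⟨-, hy'⟩ := mem_product.1 hp'
  obtain ⟨h1, h2⟩ := addTo_inj he k hy hy' h
  exact Prod.ext h1 h2

end Bij

end

end FibreSplit

end Summit.CriticalPhenomena.PercolationContinuityZ3.Theorems
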